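import Mathlib

/-!
# `disc_ladder` — compiled witness file (G4 F3) for the line `Lines/disc_ladder.lean` on
`MonotoneRestorationQP` (stmt-ValiantsHypothesis-15886)

The rung filed is `DiscRung id` (restoration up to the full marginal discriminant). Its FLOOR in the
denominator gradation is not yet a tree theorem (it is the rung itself, provable now); the pinned ends
`DiscRung 0 ↔ ComplexRestorationQP ↔ MonotoneRestorationQP` and the on-path implication
`MonotoneRestorationQP → ∀ k, DiscRung k` are kernel-checked IN the line file (`discRung_zero_iff`,
`complexRestorationQP_iff_crux`, `discRung_of_crux`).  What this file certifies is the LEVER at the first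
non-trivial size, `n = 2`, by `ring` over an arbitrary commutative ring:

* the chart `Γ = (s, p₂(R), p₂(C), T₁₁)` with `s = Σ x`, `p₂(R) = R₀² + R₁²`, `p₂(C) = C₀² + C₁²`,
  `T₁₁ = Σ_ij R_i x_ij C_j`, and the marginal discriminant `Δ = (R₀ − R₁)²(C₀ − C₁)²`;
* `discLadder_per2` : `2 · per₂ · Δ ∈ ℤ[Γ]` explicitly (12 terms) — whereas `per₂ = ad + bc` is NOT in `ℚ[Γ]`
  (degree-2 part of `ℚ[Γ]` is spanned by `s², p₂(R), p₂(C)`, dimension 3 < 4 = dim of invariant quadrics;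
  exact linear algebra, this seat, `bc/n2_chart.py`);
* `discLadder_sumsq` : `(Σ x_ij²) · Δ ∈ ℤ[Γ]` (7 terms);
* recorded, not kernel-checked (same script): `(Π x_ij) · Δ ∉ ℚ[Γ]` but `(Π x_ij) · Δ² ∈ ℚ[Γ]` (47 terms) —
  the exponent `⌈d/2⌉` of `BirationalWitness` is sharp at `d = 4`.

So at `n = 2` the denominator phenomenon is real (restoration of `per₂` through the chart NEEDS `Δ¹`) and the
identity type-checks; this is the "decidable instance" form of the witness (BC5), not a numeric floor.
-/

set_option linter.dupNamespace false

namespace Summit.ValiantsHypothesis.ValiantsHypothesis.Cruxes.MonotoneRestorationQP.DiscLadder.Special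

variable {R : Type*} [CommRing R]

/-- total sum `s = a + b + c + d` of the `2 × 2` matrix `((a, b), (c, d))`. -/
def s (a b c d : R) : R := a + b + c + d
/-- `p₂` of the row sums. -/
def pR (a b c d : R) : R := (a + b) ^ 2 + (c + d) ^ 2
/-- `p₂` of the column sums. -/
def pC (a b c d : R) : R := (a + c) ^ 2 + (b + d) ^ 2
/-- the mixed Vandermonde moment `T₁₁ = Σ_ij R_i x_ij C_j`. -/
def T (a b c d : R) : R :=
  (a + b) * (a + c) * a + (a + b) * (b + d) * b + (c + d) * (a + c) * c + (c + d) * (b + d) * d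
/-- the marginal discriminant `Δ = (R₀ − R₁)² (C₀ − C₁)²`. -/
def Δ (a b c d : R) : R := ((a + b) - (c + d)) ^ 2 * ((a + c) - (b + d)) ^ 2

/-- **n = 2 instance of `BirationalWitness` for the permanent:** `2 · per₂ · Δ` is an explicit polynomial
in the chart `Γ = (s, p₂(R), p₂(C), T₁₁)`. -/
theorem discLadder_per2 (a b c d : R) :
    2 * ((a * d + b * c) * Δ a b c d) =
      4 * T a b c d ^ 2 - 2 * pR a b c d * pC a b c d ^ 2 - 2 * pR a b c d ^ 2 * pC a b c d
        - 4 * s a b c d * pC a b c d * T a b c d - 4 * s a b c d * pR a b c d * T a b c d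
        + 2 * s a b c d ^ 2 * pC a b c d ^ 2 + 7 * s a b c d ^ 2 * pR a b c d * pC a b c d
        + 2 * s a b c d ^ 2 * pR a b c d ^ 2 + 2 * s a b c d ^ 3 * T a b c d
        - 3 * s a b c d ^ 4 * pC a b c d - 3 * s a b c d ^ 4 * pR a b c d + s a b c d ^ 6 := by
  unfold Δ T pR pC s
  ring

/-- **n = 2 instance for `Σ x_ij²`:** `(a² + b² + c² + d²) · Δ ∈ ℤ[Γ]`. -/
theorem discLadder_sumsq (a b c d : R) :
    (a ^ 2 + b ^ 2 + c ^ 2 + d ^ 2) * Δ a b c d =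
      4 * T a b c d ^ 2 + 2 * pR a b c d * pC a b c d ^ 2 + 2 * pR a b c d ^ 2 * pC a b c d
        - 4 * s a b c d * pC a b c d * T a b c d - 4 * s a b c d * pR a b c d * T a b c d
        - s a b c d ^ 2 * pR a b c d * pC a b c d + 2 * s a b c d ^ 3 * T a b c d := by
  unfold Δ T pR pC s
  ring

end Summit.ValiantsHypothesis.ValiantsHypothesis.Cruxes.MonotoneRestorationQP.DiscLadder.Special
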